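/-
Copyright: the b2b-balaban T⁴-continuum CRUX team, row NE7b OWNER lineage `t4-ne7b-p1` (gen 137). Project licence.
-/
import Summits.QuantumFields.BalabanUV.T4Continuum.Spine.NE7b.SupBlockNextHessianMatrix

/-!
# THE HESSIAN OF THE NEXT POTENTIAL OF A BLOCK INPUT IS SYMMETRIC AND UNIFORMLY BOUNDED, AND ITS GRADIENT MAP IS LIPSCHITZ — the
# class-closure plan, item (b): for a `C²` block input `U` with the block letters, the two-point upper letter `Λ ≥ 0` on `Y` and the secant
# lower letter `λ ≥ 0` (`2λ ≤ m`, over `N(0,M⁻¹)`), the Hessian `HessW(ψ)` of `W = −log Z` ((402)) is SYMMETRIC (Schwarz for the input,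
# `second_derivative_symmetric`, read through (403)'s covariance formula) and two-sided as a form (`−2λ‖v‖² ≤ HessW(ψ)[v,v] ≤ Λ‖v‖²`, (403)),
# hence by POLARISATION
#   `‖HessW(ψ)‖ ≤ 2λ + Λ`   at EVERY `ψ`, uniformly in the background and the volume,
# and by the MEAN VALUE THEOREM on the gradient map `‖DW(ψ′) − DW(ψ)‖ ≤ (2λ+Λ)‖ψ′−ψ‖` — the two inputs of the output's `κ₂⁺` and `κ₁⁺`
# letters (successor file) (row NE7b, node U5c; (399)∕(402)∕(403) BY NAME; [folklore])

Cell `pub-balaban`, sub-cell `t4`, spine estimate NE7b (`T4WeightBudget.RelWeightBound`; the cell's OWN estimate — NOT PRINTED in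
[Bałaban 1983–89], NOT PROVED).  Crux-route work under `Spine/NE7b/` by the row OWNER (`t4-ne7b-p1` gen 137, file (416)) under FREEZE
(0)'s crux-prover clause (this gen's class-closure audit, item (b)); NOTHING of Bałaban's is named as a Lean object, valued or asserted; no
`T4Continuum/Support` leaf typed; no `def`, no notation; zero `sorry`.  Imports (BY NAME): the OWNER's (404) `…SupBlockNextHessianMatrix` and
through it (403) (`hessian_block_neg_log_apply∕ge∕le`), (402) (`hasFDerivAt_fderiv_block_neg_log`), (399) (`hasFDerivAt_block_neg_log`);
Mathlib's `second_derivative_symmetric`, `ContinuousLinearMap.opNorm_le_of_unit_norm`, `parallelogram_law_with_norm`,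
`Convex.norm_image_sub_le_of_norm_hasFDerivWithin_le`.

WHAT IS PROVED ([folklore]):
* §1 `opNorm_le_of_symm_form_bound` (a symmetric bilinear form with `|B(v,v)| ≤ c‖v‖²` has `‖B‖ ≤ c`);
* §2 `hessW_symm`, `hessW_form_bound`, **`hessW_opNorm_le`** (`‖HessW(ψ)‖ ≤ 2λ+Λ` at every `ψ`), **`gradient_sub_le`** (mean value:
  `‖DW(ψ′) − DW(ψ)‖ ≤ (2λ+Λ)‖ψ′−ψ‖`), **`blockOutput_second_letter`** (`‖(w⁺)″(ζ)‖ ≤ 2(2λ+Λ)` for (415)'s `(w⁺)″`),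
  **`blockOutput_gradient_letter`** (`‖(w⁺)′(ζ)‖ ≤ 2(2λ+Λ)‖ζ‖ ≤ (2λ+Λ)(1+Σ_iζ_i²)`); §3 toy.

HONEST (what this is NOT).  Uniform SECOND-order information only; the output's letters, the third Fréchet derivative with a UNIFORM `κ₃⁺`
(log-concave concentration) remain in the plan; no contraction ((β4)), no decaying-covariance polymer expansion ((β3′)); scalar skeleton
((A3), NC-NE7b-α UNRULED); nothing of Bałaban's asserted.  BY-NAME EFFECT ON THE WALL: NONE.  NE7b NOT PRINTED ∕ NOT PROVED; spine PROVED 0∕9;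
rung (B)+1 — the programme's measures remain FINITE-torus statements; NOT the mass gap, NOT Clay.  HONEST DEPENDENCY: continuum YM on T⁴ ⇐
BetaPertH ∧ nine spine estimates (0∕9 proved); BetaPertH ⇐ (D1) ∧ (D4) ∧ CAP+tail; G-an2-4 gates asym, D1 and NE2∕3∕4.
-/

set_option autoImplicit false
set_option maxSynthPendingDepth 2

noncomputable section

namespace Summit.QuantumFields.BalabanUV.T4Continuum.NE7b.SupBlockHessianBound

open MeasureTheory ProbabilityTheory Finset Real Matrix
open scoped BigOperators
open SupBlockEffectiveActionDerivative (hasFDerivAt_block_neg_log)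
open SupBlockEffectiveActionHessian (hasFDerivAt_fderiv_block_neg_log)
open SupBlockEffectiveActionCovariance (hessian_block_neg_log_apply hessian_block_neg_log_ge hessian_block_neg_log_le)

variable {ι : Type} [Fintype ι] [DecidableEq ι]

/-! ## §1. A symmetric bilinear form is bounded by its quadratic form -/

omit [DecidableEq ι] in
/-- **Polarisation**: a SYMMETRIC continuous bilinear form `B` on `ℝ^ι` with `|B(v,v)| ≤ c‖v‖²` (`c ≥ 0`) has operator norm `‖B‖ ≤ c`
(`4B(h,k) = B(h+k,h+k) − B(h−k,h−k)` and the parallelogram law). [folklore] -/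
theorem opNorm_le_of_symm_form_bound (B : EuclideanSpace ℝ ι →L[ℝ] EuclideanSpace ℝ ι →L[ℝ] ℝ) (hsymm : ∀ h k, B h k = B k h) {c : ℝ}
    (hc : 0 ≤ c) (hform : ∀ v, |B v v| ≤ c * ‖v‖ ^ 2) : ‖B‖ ≤ c := by
  refine ContinuousLinearMap.opNorm_le_of_unit_norm hc fun h hh => ?_
  refine ContinuousLinearMap.opNorm_le_of_unit_norm hc fun k hk => ?_
  have hpol : B h k = (B (h + k) (h + k) - B (h - k) (h - k)) / 4 := by
    have e1 : B (h + k) (h + k) = B h h + B h k + B k h + B k k := by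
      rw [map_add B, _root_.add_apply, map_add (B h), map_add (B k)]; ring
    have e2 : B (h - k) (h - k) = B h h - B h k - B k h + B k k := by
      rw [map_sub B, _root_.sub_apply, map_sub (B h), map_sub (B k)]; ring
    rw [e1, e2, hsymm k h]; ring
  have hpar := parallelogram_law_with_norm ℝ h k
  rw [hh, hk] at hpar
  have h1 := hform (h + k)
  have h2 := hform (h - k)
  rw [Real.norm_eq_abs, hpol, abs_div, abs_of_pos (by norm_num : (0:ℝ) < 4)]
  have h3 : |B (h + k) (h + k) - B (h - k) (h - k)| ≤ c * ‖h + k‖ ^ 2 + c * ‖h - k‖ ^ 2 := (abs_sub _ _).trans (add_le_add h1 h2)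
  have h4 : c * ‖h + k‖ ^ 2 + c * ‖h - k‖ ^ 2 = 4 * c := by rw [← mul_add, hpar]; ring
  rw [h4] at h3
  linarith

/-! ## §2. The Hessian of `W` is symmetric and uniformly bounded; the gradient map is Lipschitz -/

section Second

variable {M : Matrix ι ι ℝ} {γop m lam : ℝ} {U : EuclideanSpace ℝ ι → ℝ} {U' : EuclideanSpace ℝ ι → EuclideanSpace ℝ ι →L[ℝ] ℝ}
  {U'' : EuclideanSpace ℝ ι → EuclideanSpace ℝ ι →L[ℝ] EuclideanSpace ℝ ι →L[ℝ] ℝ} {κ₀ κ₁ κ₂ a τ δ θ : ℝ}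

/-- **THE HESSIAN OF `W` IS SYMMETRIC** (the covariance formula (403) and Schwarz for the input, `second_derivative_symmetric`). [folklore] -/
theorem hessW_symm (hM : M.PosDef) (hΓop : (γop • (1 : Matrix ι ι ℝ) - M⁻¹).PosSemidef) (Y : Finset ι)
    (hUd : ∀ φ : EuclideanSpace ℝ ι, HasFDerivAt U (U' φ) φ) (hU'd : ∀ φ : EuclideanSpace ℝ ι, HasFDerivAt U' (U'' φ) φ)
    (hU''c : Continuous U'') (hκ₀ : 0 ≤ κ₀) (hκ₁ : 0 ≤ κ₁) (ha : 0 ≤ a) (hκ₂ : 0 ≤ κ₂) (hτ : 0 < τ) (hδ : 0 < δ) (hθ1 : θ < 1)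
    (hκθ : (2 * κ₀ * (1 + τ) + 4 * δ) * γop ≤ θ) (hstab : ∀ φ : EuclideanSpace ℝ ι, -(κ₀ * ∑ x ∈ Y, φ x ^ 2) ≤ U φ)
    (hU'b : ∀ φ : EuclideanSpace ℝ ι, ‖U' φ‖ ≤ κ₁ * (a + ∑ x ∈ Y, φ x ^ 2)) (hU''b : ∀ φ : EuclideanSpace ℝ ι, ‖U'' φ‖ ≤ κ₂) (ψ h k : EuclideanSpace ℝ ι) :
    ((∫ ω : EuclideanSpace ℝ ι, exp (-U (ω + ψ)) ∂(multivariateGaussian 0 M⁻¹))⁻¹ • (∫ ω : EuclideanSpace ℝ ι, exp (-U (ω + ψ)) • (U'' (ω + ψ) - (U' (ω + ψ)).smulRight (U'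
        (ω + ψ))) ∂(multivariateGaussian 0 M⁻¹)) + (((∫ ω : EuclideanSpace ℝ ι, exp (-U (ω + ψ)) ∂(multivariateGaussian 0 M⁻¹)) ^ 2)⁻¹ • ∫ ω : EuclideanSpace ℝ ι, exp (-U
        (ω + ψ)) • U' (ω + ψ) ∂(multivariateGaussian 0 M⁻¹)).smulRight (∫ ω : EuclideanSpace ℝ ι, exp (-U (ω + ψ)) • U' (ω + ψ) ∂(multivariateGaussian 0 M⁻¹))) h k = ((∫ ω
        : EuclideanSpace ℝ ι, exp (-U (ω + ψ)) ∂(multivariateGaussian 0 M⁻¹))⁻¹ • (∫ ω : EuclideanSpace ℝ ι, exp (-U (ω + ψ)) • (U'' (ω + ψ) - (U' (ω + ψ)).smulRight (U' (ω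
        + ψ))) ∂(multivariateGaussian 0 M⁻¹)) + (((∫ ω : EuclideanSpace ℝ ι, exp (-U (ω + ψ)) ∂(multivariateGaussian 0 M⁻¹)) ^ 2)⁻¹ • ∫ ω : EuclideanSpace ℝ ι, exp (-U (ω +
        ψ)) • U' (ω + ψ) ∂(multivariateGaussian 0 M⁻¹)).smulRight (∫ ω : EuclideanSpace ℝ ι, exp (-U (ω + ψ)) • U' (ω + ψ) ∂(multivariateGaussian 0 M⁻¹))) k h := by
  have hΓ : (M⁻¹).PosSemidef := hM.inv.posSemidef
  rw [hessian_block_neg_log_apply hΓ hΓop Y hUd hU'd hU''c hκ₀ hκ₁ ha hκ₂ hτ hδ hθ1 hκθ hstab hU'b hU''b ψ h k, hessian_block_neg_log_apply hΓ hΓop Y hUd hU'd hU''c hκ₀ hκ₁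
      ha hκ₂ hτ hδ hθ1 hκθ hstab hU'b hU''b ψ k h]
  have hsw : ∀ ω : EuclideanSpace ℝ ι, U'' (ω + ψ) h k = U'' (ω + ψ) k h := fun ω => second_derivative_symmetric hUd (hU'd (ω + ψ)) h k
  have e : (∫ ω : EuclideanSpace ℝ ι, exp (-U (ω + ψ)) * (U'' (ω + ψ) h k - U' (ω + ψ) h * U' (ω + ψ) k) ∂(multivariateGaussian 0 M⁻¹)) =
      ∫ ω : EuclideanSpace ℝ ι, exp (-U (ω + ψ)) * (U'' (ω + ψ) k h - U' (ω + ψ) k * U' (ω + ψ) h) ∂(multivariateGaussian 0 M⁻¹) :=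
    integral_congr_ae (ae_of_all _ fun ω => by dsimp only; rw [hsw ω, mul_comm (U' (ω + ψ) h) (U' (ω + ψ) k)])
  rw [e, mul_comm (∫ ω : EuclideanSpace ℝ ι, exp (-U (ω + ψ)) * U' (ω + ψ) h ∂(multivariateGaussian 0 M⁻¹)) (∫ ω : EuclideanSpace ℝ ι, exp (-U (ω + ψ)) * U' (ω + ψ) k
      ∂(multivariateGaussian 0 M⁻¹))]

/-- **THE HESSIAN OF `W` IS TWO-SIDED AS A FORM ON ALL OF `ℝ^ι`**: `|HessW(ψ)[v,v]| ≤ (2λ+Λ)‖v‖²` ((403)'s letters, `Σ_Y ≤ Σ_i = ‖v‖²`). [folklore] -/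
theorem hessW_form_bound (hM : M.PosDef) (hfl : ∀ z : ι → ℝ, m * ∑ i, z i ^ 2 ≤ z ⬝ᵥ (M *ᵥ z)) (hΓop : (γop • (1 : Matrix ι ι ℝ) - M⁻¹).PosSemidef) (Y : Finset ι)
    (hUd : ∀ φ : EuclideanSpace ℝ ι, HasFDerivAt U (U' φ) φ) (hU'd : ∀ φ : EuclideanSpace ℝ ι, HasFDerivAt U' (U'' φ) φ)
    (hU''c : Continuous U'') (hκ₀ : 0 ≤ κ₀) (hκ₁ : 0 ≤ κ₁) (ha : 0 ≤ a) (hκ₂ : 0 ≤ κ₂) (hτ : 0 < τ) (hδ : 0 < δ) (hθ0 : 0 < θ) (hθ1 : θ < 1)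
    (hκθ : (2 * κ₀ * (1 + τ) + 4 * δ) * γop ≤ θ) (hstab : ∀ φ : EuclideanSpace ℝ ι, -(κ₀ * ∑ x ∈ Y, φ x ^ 2) ≤ U φ)
    (hU'b : ∀ φ : EuclideanSpace ℝ ι, ‖U' φ‖ ≤ κ₁ * (a + ∑ x ∈ Y, φ x ^ 2)) (hU''b : ∀ φ : EuclideanSpace ℝ ι, ‖U'' φ‖ ≤ κ₂) {Λ : ℝ} (hΛ : 0 ≤ Λ)
    (hwup : ∀ φ φ' : EuclideanSpace ℝ ι, U φ' ≤ U φ + U' φ (φ' - φ) + Λ / 2 * ∑ x ∈ Y, (φ' x - φ x) ^ 2) (hlam : 0 ≤ lam)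
    (hUsec : ∀ s : ℝ, 0 ≤ s → s ≤ 1 → ∀ a b : EuclideanSpace ℝ ι,
      U ((1 - s) • a + s • b) - lam / 2 * (s * (1 - s)) * ∑ i, (a i - b i) ^ 2 ≤ (1 - s) * U a + s * U b)
    (hm : 2 * lam ≤ m) (ψ v : EuclideanSpace ℝ ι) :
    |((∫ ω : EuclideanSpace ℝ ι, exp (-U (ω + ψ)) ∂(multivariateGaussian 0 M⁻¹))⁻¹ • (∫ ω : EuclideanSpace ℝ ι, exp (-U (ω + ψ)) • (U'' (ω + ψ) - (U' (ω + ψ)).smulRight (U'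
        (ω + ψ))) ∂(multivariateGaussian 0 M⁻¹)) + (((∫ ω : EuclideanSpace ℝ ι, exp (-U (ω + ψ)) ∂(multivariateGaussian 0 M⁻¹)) ^ 2)⁻¹ • ∫ ω : EuclideanSpace ℝ ι, exp (-U
        (ω + ψ)) • U' (ω + ψ) ∂(multivariateGaussian 0 M⁻¹)).smulRight (∫ ω : EuclideanSpace ℝ ι, exp (-U (ω + ψ)) • U' (ω + ψ) ∂(multivariateGaussian 0 M⁻¹))) v v| ≤ (2 *
        lam + Λ) * ‖v‖ ^ 2 := by
  have hΓ : (M⁻¹).PosSemidef := hM.inv.posSemidef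
  have hge := hessian_block_neg_log_ge hM hfl hΓop Y hUd hU'd hU''c hκ₀ hκ₁ ha hκ₂ hτ hδ hθ0 hθ1 hκθ hstab hU'b hU''b hlam hUsec hm ψ v
  have hle := hessian_block_neg_log_le hΓ hΓop Y hUd hU'd hU''c hκ₀ hκ₁ ha hκ₂ hτ hδ hθ0 hθ1 hκθ hstab hU'b hU''b hwup ψ v
  have hn : ‖v‖ ^ 2 = ∑ i, v i ^ 2 := EuclideanSpace.real_norm_sq_eq v
  have hY : ∑ x ∈ Y, v x ^ 2 ≤ ∑ i, v i ^ 2 := Finset.sum_le_univ_sum_of_nonneg fun i => sq_nonneg (v i)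
  have h0 : 0 ≤ ∑ i, v i ^ 2 := Finset.sum_nonneg fun i _ => sq_nonneg (v i)
  rw [hn, abs_le]
  constructor
  · nlinarith
  · nlinarith

/-- **THE HESSIAN OF `W` IS UNIFORMLY BOUNDED**: `‖HessW(ψ)‖ ≤ 2λ + Λ` at EVERY `ψ` (symmetry + form bound + polarisation). [folklore] -/
theorem hessW_opNorm_le (hM : M.PosDef) (hfl : ∀ z : ι → ℝ, m * ∑ i, z i ^ 2 ≤ z ⬝ᵥ (M *ᵥ z)) (hΓop : (γop • (1 : Matrix ι ι ℝ) - M⁻¹).PosSemidef) (Y : Finset ι)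
    (hUd : ∀ φ : EuclideanSpace ℝ ι, HasFDerivAt U (U' φ) φ) (hU'd : ∀ φ : EuclideanSpace ℝ ι, HasFDerivAt U' (U'' φ) φ)
    (hU''c : Continuous U'') (hκ₀ : 0 ≤ κ₀) (hκ₁ : 0 ≤ κ₁) (ha : 0 ≤ a) (hκ₂ : 0 ≤ κ₂) (hτ : 0 < τ) (hδ : 0 < δ) (hθ0 : 0 < θ) (hθ1 : θ < 1)
    (hκθ : (2 * κ₀ * (1 + τ) + 4 * δ) * γop ≤ θ) (hstab : ∀ φ : EuclideanSpace ℝ ι, -(κ₀ * ∑ x ∈ Y, φ x ^ 2) ≤ U φ)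
    (hU'b : ∀ φ : EuclideanSpace ℝ ι, ‖U' φ‖ ≤ κ₁ * (a + ∑ x ∈ Y, φ x ^ 2)) (hU''b : ∀ φ : EuclideanSpace ℝ ι, ‖U'' φ‖ ≤ κ₂) {Λ : ℝ} (hΛ : 0 ≤ Λ)
    (hwup : ∀ φ φ' : EuclideanSpace ℝ ι, U φ' ≤ U φ + U' φ (φ' - φ) + Λ / 2 * ∑ x ∈ Y, (φ' x - φ x) ^ 2) (hlam : 0 ≤ lam)
    (hUsec : ∀ s : ℝ, 0 ≤ s → s ≤ 1 → ∀ a b : EuclideanSpace ℝ ι,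
      U ((1 - s) • a + s • b) - lam / 2 * (s * (1 - s)) * ∑ i, (a i - b i) ^ 2 ≤ (1 - s) * U a + s * U b)
    (hm : 2 * lam ≤ m) (ψ : EuclideanSpace ℝ ι) :
    ‖((∫ ω : EuclideanSpace ℝ ι, exp (-U (ω + ψ)) ∂(multivariateGaussian 0 M⁻¹))⁻¹ • (∫ ω : EuclideanSpace ℝ ι, exp (-U (ω + ψ)) • (U'' (ω + ψ) - (U' (ω + ψ)).smulRight (U'
        (ω + ψ))) ∂(multivariateGaussian 0 M⁻¹)) + (((∫ ω : EuclideanSpace ℝ ι, exp (-U (ω + ψ)) ∂(multivariateGaussian 0 M⁻¹)) ^ 2)⁻¹ • ∫ ω : EuclideanSpace ℝ ι, exp (-U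
        (ω + ψ)) • U' (ω + ψ) ∂(multivariateGaussian 0 M⁻¹)).smulRight (∫ ω : EuclideanSpace ℝ ι, exp (-U (ω + ψ)) • U' (ω + ψ) ∂(multivariateGaussian 0 M⁻¹)))‖ ≤ 2 * lam +
        Λ :=
  opNorm_le_of_symm_form_bound _ (fun h k => hessW_symm hM hΓop Y hUd hU'd hU''c hκ₀ hκ₁ ha hκ₂ hτ hδ hθ1 hκθ hstab hU'b hU''b ψ h k) (by positivity) (fun v =>
      hessW_form_bound hM hfl hΓop Y hUd hU'd hU''c hκ₀ hκ₁ ha hκ₂ hτ hδ hθ0 hθ1 hκθ hstab hU'b hU''b hΛ hwup hlam hUsec hm ψ v)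

/-- **MEAN VALUE ON THE GRADIENT MAP**: `‖DW(ψ′) − DW(ψ)‖ ≤ (2λ+Λ)·‖ψ′−ψ‖` (the gradient map has derivative `HessW` (402), bounded by §2).
[folklore] -/
theorem gradient_sub_le (hM : M.PosDef) (hfl : ∀ z : ι → ℝ, m * ∑ i, z i ^ 2 ≤ z ⬝ᵥ (M *ᵥ z)) (hΓop : (γop • (1 : Matrix ι ι ℝ) - M⁻¹).PosSemidef) (Y : Finset ι)
    (hUd : ∀ φ : EuclideanSpace ℝ ι, HasFDerivAt U (U' φ) φ) (hU'd : ∀ φ : EuclideanSpace ℝ ι, HasFDerivAt U' (U'' φ) φ)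
    (hU''c : Continuous U'') (hκ₀ : 0 ≤ κ₀) (hκ₁ : 0 ≤ κ₁) (ha : 0 ≤ a) (hκ₂ : 0 ≤ κ₂) (hτ : 0 < τ) (hδ : 0 < δ) (hθ0 : 0 < θ) (hθ1 : θ < 1)
    (hκθ : (2 * κ₀ * (1 + τ) + 4 * δ) * γop ≤ θ) (hstab : ∀ φ : EuclideanSpace ℝ ι, -(κ₀ * ∑ x ∈ Y, φ x ^ 2) ≤ U φ)
    (hU'b : ∀ φ : EuclideanSpace ℝ ι, ‖U' φ‖ ≤ κ₁ * (a + ∑ x ∈ Y, φ x ^ 2)) (hU''b : ∀ φ : EuclideanSpace ℝ ι, ‖U'' φ‖ ≤ κ₂) {Λ : ℝ} (hΛ : 0 ≤ Λ)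
    (hwup : ∀ φ φ' : EuclideanSpace ℝ ι, U φ' ≤ U φ + U' φ (φ' - φ) + Λ / 2 * ∑ x ∈ Y, (φ' x - φ x) ^ 2) (hlam : 0 ≤ lam)
    (hUsec : ∀ s : ℝ, 0 ≤ s → s ≤ 1 → ∀ a b : EuclideanSpace ℝ ι,
      U ((1 - s) • a + s • b) - lam / 2 * (s * (1 - s)) * ∑ i, (a i - b i) ^ 2 ≤ (1 - s) * U a + s * U b)
    (hm : 2 * lam ≤ m) (ψ ψ' : EuclideanSpace ℝ ι) :
    ‖((∫ ω : EuclideanSpace ℝ ι, exp (-U (ω + ψ')) ∂(multivariateGaussian 0 M⁻¹))⁻¹ • ∫ ω : EuclideanSpace ℝ ι, exp (-U (ω + ψ')) • U' (ω + ψ') ∂(multivariateGaussian 0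
        M⁻¹)) - ((∫ ω : EuclideanSpace ℝ ι, exp (-U (ω + ψ)) ∂(multivariateGaussian 0 M⁻¹))⁻¹ • ∫ ω : EuclideanSpace ℝ ι, exp (-U (ω + ψ)) • U' (ω + ψ)
        ∂(multivariateGaussian 0 M⁻¹))‖ ≤ (2 * lam + Λ) * ‖ψ' - ψ‖ := by
  have hΓ : (M⁻¹).PosSemidef := hM.inv.posSemidef
  have hU'c : Continuous U' := continuous_iff_continuousAt.2 fun φ => (hU'd φ).continuousAt
  have hgrad : (fun χ : EuclideanSpace ℝ ι => ((∫ ω : EuclideanSpace ℝ ι, exp (-U (ω + χ)) ∂(multivariateGaussian 0 M⁻¹))⁻¹ • ∫ ω : EuclideanSpace ℝ ι, exp (-U (ω + χ)) •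
      U' (ω + χ) ∂(multivariateGaussian 0 M⁻¹))) = fun χ => fderiv ℝ (fun φ : EuclideanSpace ℝ ι => -Real.log (∫ ω : EuclideanSpace ℝ ι, exp (-U (ω + φ))
      ∂(multivariateGaussian 0 M⁻¹))) χ :=
    funext fun χ => ((hasFDerivAt_block_neg_log hΓ hΓop Y hUd hU'c hκ₀ hκ₁ ha hτ hδ hθ0 hθ1 hκθ hstab hU'b χ).fderiv).symm
  have hd : ∀ χ : EuclideanSpace ℝ ι, HasFDerivAt (fun χ : EuclideanSpace ℝ ι => ((∫ ω : EuclideanSpace ℝ ι, exp (-U (ω + χ)) ∂(multivariateGaussian 0 M⁻¹))⁻¹ • ∫ ω :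
      EuclideanSpace ℝ ι, exp (-U (ω + χ)) • U' (ω + χ) ∂(multivariateGaussian 0 M⁻¹))) ((∫ ω : EuclideanSpace ℝ ι, exp (-U (ω + χ)) ∂(multivariateGaussian 0 M⁻¹))⁻¹ • (∫ ω
      : EuclideanSpace ℝ ι, exp (-U (ω + χ)) • (U'' (ω + χ) - (U' (ω + χ)).smulRight (U' (ω + χ))) ∂(multivariateGaussian 0 M⁻¹)) + (((∫ ω : EuclideanSpace ℝ ι, exp (-U (ω
      + χ)) ∂(multivariateGaussian 0 M⁻¹)) ^ 2)⁻¹ • ∫ ω : EuclideanSpace ℝ ι, exp (-U (ω + χ)) • U' (ω + χ) ∂(multivariateGaussian 0 M⁻¹)).smulRight (∫ ω : EuclideanSpace ℝ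
      ι, exp (-U (ω + χ)) • U' (ω + χ) ∂(multivariateGaussian 0 M⁻¹))) χ := fun χ => by
    rw [hgrad]; exact hasFDerivAt_fderiv_block_neg_log hΓ hΓop Y hUd hU'd hU''c hκ₀ hκ₁ ha hκ₂ hτ hδ hθ0 hθ1 hκθ hstab hU'b hU''b χ
  exact convex_univ.norm_image_sub_le_of_norm_hasFDerivWithin_le (fun χ _ => (hd χ).hasFDerivWithinAt)
    (fun χ _ => hessW_opNorm_le hM hfl hΓop Y hUd hU'd hU''c hκ₀ hκ₁ ha hκ₂ hτ hδ hθ0 hθ1 hκθ hstab hU'b hU''b hΛ hwup hlam hUsec hm χ) (Set.mem_univ ψ) (Set.mem_univ ψ')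

/-- **THE OUTPUT'S SECOND LETTER**: `‖(w⁺)″(ζ)‖ = ‖HessW(ψ₀+ζ) − ½(L+Lᵀ)‖ ≤ 2(2λ+Λ)` at EVERY `ζ` (`L = HessW(ψ₀)`, `‖Lᵀ‖ = ‖L‖`) — the input
format's `hU''b` with `κ₂⁺ = 2(2λ+Λ)`, UNIFORM in the background and the volume. [folklore] -/
theorem blockOutput_second_letter (hM : M.PosDef) (hfl : ∀ z : ι → ℝ, m * ∑ i, z i ^ 2 ≤ z ⬝ᵥ (M *ᵥ z)) (hΓop : (γop • (1 : Matrix ι ι ℝ) - M⁻¹).PosSemidef) (Y : Finset ι)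
    (hUd : ∀ φ : EuclideanSpace ℝ ι, HasFDerivAt U (U' φ) φ) (hU'd : ∀ φ : EuclideanSpace ℝ ι, HasFDerivAt U' (U'' φ) φ)
    (hU''c : Continuous U'') (hκ₀ : 0 ≤ κ₀) (hκ₁ : 0 ≤ κ₁) (ha : 0 ≤ a) (hκ₂ : 0 ≤ κ₂) (hτ : 0 < τ) (hδ : 0 < δ) (hθ0 : 0 < θ) (hθ1 : θ < 1)
    (hκθ : (2 * κ₀ * (1 + τ) + 4 * δ) * γop ≤ θ) (hstab : ∀ φ : EuclideanSpace ℝ ι, -(κ₀ * ∑ x ∈ Y, φ x ^ 2) ≤ U φ)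
    (hU'b : ∀ φ : EuclideanSpace ℝ ι, ‖U' φ‖ ≤ κ₁ * (a + ∑ x ∈ Y, φ x ^ 2)) (hU''b : ∀ φ : EuclideanSpace ℝ ι, ‖U'' φ‖ ≤ κ₂) {Λ : ℝ} (hΛ : 0 ≤ Λ)
    (hwup : ∀ φ φ' : EuclideanSpace ℝ ι, U φ' ≤ U φ + U' φ (φ' - φ) + Λ / 2 * ∑ x ∈ Y, (φ' x - φ x) ^ 2) (hlam : 0 ≤ lam)
    (hUsec : ∀ s : ℝ, 0 ≤ s → s ≤ 1 → ∀ a b : EuclideanSpace ℝ ι,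
      U ((1 - s) • a + s • b) - lam / 2 * (s * (1 - s)) * ∑ i, (a i - b i) ^ 2 ≤ (1 - s) * U a + s * U b)
    (hm : 2 * lam ≤ m) (ψ₀ ζ : EuclideanSpace ℝ ι) :
    ‖(((∫ ω : EuclideanSpace ℝ ι, exp (-U (ω + (ψ₀ + ζ))) ∂(multivariateGaussian 0 M⁻¹))⁻¹ • (∫ ω : EuclideanSpace ℝ ι, exp (-U (ω + (ψ₀ + ζ))) • (U'' (ω + (ψ₀ + ζ)) - (U'
        (ω + (ψ₀ + ζ))).smulRight (U' (ω + (ψ₀ + ζ)))) ∂(multivariateGaussian 0 M⁻¹)) + (((∫ ω : EuclideanSpace ℝ ι, exp (-U (ω + (ψ₀ + ζ))) ∂(multivariateGaussian 0 M⁻¹))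
        ^ 2)⁻¹ • ∫ ω : EuclideanSpace ℝ ι, exp (-U (ω + (ψ₀ + ζ))) • U' (ω + (ψ₀ + ζ)) ∂(multivariateGaussian 0 M⁻¹)).smulRight (∫ ω : EuclideanSpace ℝ ι, exp (-U (ω + (ψ₀
        + ζ))) • U' (ω + (ψ₀ + ζ)) ∂(multivariateGaussian 0 M⁻¹))) - ((2 : ℝ)⁻¹ • (((∫ ω : EuclideanSpace ℝ ι, exp (-U (ω + ψ₀)) ∂(multivariateGaussian 0 M⁻¹))⁻¹ • (∫ ω :
        EuclideanSpace ℝ ι, exp (-U (ω + ψ₀)) • (U'' (ω + ψ₀) - (U' (ω + ψ₀)).smulRight (U' (ω + ψ₀))) ∂(multivariateGaussian 0 M⁻¹)) + (((∫ ω : EuclideanSpace ℝ ι, exp (-U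
        (ω + ψ₀)) ∂(multivariateGaussian 0 M⁻¹)) ^ 2)⁻¹ • ∫ ω : EuclideanSpace ℝ ι, exp (-U (ω + ψ₀)) • U' (ω + ψ₀) ∂(multivariateGaussian 0 M⁻¹)).smulRight (∫ ω :
        EuclideanSpace ℝ ι, exp (-U (ω + ψ₀)) • U' (ω + ψ₀) ∂(multivariateGaussian 0 M⁻¹))) + (((∫ ω : EuclideanSpace ℝ ι, exp (-U (ω + ψ₀)) ∂(multivariateGaussian 0
        M⁻¹))⁻¹ • (∫ ω : EuclideanSpace ℝ ι, exp (-U (ω + ψ₀)) • (U'' (ω + ψ₀) - (U' (ω + ψ₀)).smulRight (U' (ω + ψ₀))) ∂(multivariateGaussian 0 M⁻¹)) + (((∫ ω :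
        EuclideanSpace ℝ ι, exp (-U (ω + ψ₀)) ∂(multivariateGaussian 0 M⁻¹)) ^ 2)⁻¹ • ∫ ω : EuclideanSpace ℝ ι, exp (-U (ω + ψ₀)) • U' (ω + ψ₀) ∂(multivariateGaussian 0
        M⁻¹)).smulRight (∫ ω : EuclideanSpace ℝ ι, exp (-U (ω + ψ₀)) • U' (ω + ψ₀) ∂(multivariateGaussian 0 M⁻¹)))).flip)))‖ ≤ 2 * (2 * lam + Λ) := by
  have h1 := hessW_opNorm_le hM hfl hΓop Y hUd hU'd hU''c hκ₀ hκ₁ ha hκ₂ hτ hδ hθ0 hθ1 hκθ hstab hU'b hU''b hΛ hwup hlam hUsec hm (ψ₀ + ζ)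
  have h0 := hessW_opNorm_le hM hfl hΓop Y hUd hU'd hU''c hκ₀ hκ₁ ha hκ₂ hτ hδ hθ0 hθ1 hκθ hstab hU'b hU''b hΛ hwup hlam hUsec hm ψ₀
  have hflip : ‖(((∫ ω : EuclideanSpace ℝ ι, exp (-U (ω + ψ₀)) ∂(multivariateGaussian 0 M⁻¹))⁻¹ • (∫ ω : EuclideanSpace ℝ ι, exp (-U (ω + ψ₀)) • (U'' (ω + ψ₀) - (U' (ω +
      ψ₀)).smulRight (U' (ω + ψ₀))) ∂(multivariateGaussian 0 M⁻¹)) + (((∫ ω : EuclideanSpace ℝ ι, exp (-U (ω + ψ₀)) ∂(multivariateGaussian 0 M⁻¹)) ^ 2)⁻¹ • ∫ ω :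
      EuclideanSpace ℝ ι, exp (-U (ω + ψ₀)) • U' (ω + ψ₀) ∂(multivariateGaussian 0 M⁻¹)).smulRight (∫ ω : EuclideanSpace ℝ ι, exp (-U (ω + ψ₀)) • U' (ω + ψ₀)
      ∂(multivariateGaussian 0 M⁻¹)))).flip‖ ≤ 2 * lam + Λ := by rw [ContinuousLinearMap.opNorm_flip]; exact h0
  have hK : ‖((2 : ℝ)⁻¹ • (((∫ ω : EuclideanSpace ℝ ι, exp (-U (ω + ψ₀)) ∂(multivariateGaussian 0 M⁻¹))⁻¹ • (∫ ω : EuclideanSpace ℝ ι, exp (-U (ω + ψ₀)) • (U'' (ω + ψ₀) -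
      (U' (ω + ψ₀)).smulRight (U' (ω + ψ₀))) ∂(multivariateGaussian 0 M⁻¹)) + (((∫ ω : EuclideanSpace ℝ ι, exp (-U (ω + ψ₀)) ∂(multivariateGaussian 0 M⁻¹)) ^ 2)⁻¹ • ∫ ω :
      EuclideanSpace ℝ ι, exp (-U (ω + ψ₀)) • U' (ω + ψ₀) ∂(multivariateGaussian 0 M⁻¹)).smulRight (∫ ω : EuclideanSpace ℝ ι, exp (-U (ω + ψ₀)) • U' (ω + ψ₀)
      ∂(multivariateGaussian 0 M⁻¹))) + (((∫ ω : EuclideanSpace ℝ ι, exp (-U (ω + ψ₀)) ∂(multivariateGaussian 0 M⁻¹))⁻¹ • (∫ ω : EuclideanSpace ℝ ι, exp (-U (ω + ψ₀)) •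
      (U'' (ω + ψ₀) - (U' (ω + ψ₀)).smulRight (U' (ω + ψ₀))) ∂(multivariateGaussian 0 M⁻¹)) + (((∫ ω : EuclideanSpace ℝ ι, exp (-U (ω + ψ₀)) ∂(multivariateGaussian 0 M⁻¹))
      ^ 2)⁻¹ • ∫ ω : EuclideanSpace ℝ ι, exp (-U (ω + ψ₀)) • U' (ω + ψ₀) ∂(multivariateGaussian 0 M⁻¹)).smulRight (∫ ω : EuclideanSpace ℝ ι, exp (-U (ω + ψ₀)) • U' (ω + ψ₀)
      ∂(multivariateGaussian 0 M⁻¹)))).flip))‖ ≤ 2 * lam + Λ := by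
    refine (norm_smul_le ((2 : ℝ)⁻¹) (((∫ ω : EuclideanSpace ℝ ι, exp (-U (ω + ψ₀)) ∂(multivariateGaussian 0 M⁻¹))⁻¹ • (∫ ω : EuclideanSpace ℝ ι, exp (-U (ω + ψ₀)) • (U''
        (ω + ψ₀) - (U' (ω + ψ₀)).smulRight (U' (ω + ψ₀))) ∂(multivariateGaussian 0 M⁻¹)) + (((∫ ω : EuclideanSpace ℝ ι, exp (-U (ω + ψ₀)) ∂(multivariateGaussian 0 M⁻¹)) ^
        2)⁻¹ • ∫ ω : EuclideanSpace ℝ ι, exp (-U (ω + ψ₀)) • U' (ω + ψ₀) ∂(multivariateGaussian 0 M⁻¹)).smulRight (∫ ω : EuclideanSpace ℝ ι, exp (-U (ω + ψ₀)) • U' (ω + ψ₀)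
        ∂(multivariateGaussian 0 M⁻¹))) + (((∫ ω : EuclideanSpace ℝ ι, exp (-U (ω + ψ₀)) ∂(multivariateGaussian 0 M⁻¹))⁻¹ • (∫ ω : EuclideanSpace ℝ ι, exp (-U (ω + ψ₀)) •
        (U'' (ω + ψ₀) - (U' (ω + ψ₀)).smulRight (U' (ω + ψ₀))) ∂(multivariateGaussian 0 M⁻¹)) + (((∫ ω : EuclideanSpace ℝ ι, exp (-U (ω + ψ₀)) ∂(multivariateGaussian 0
        M⁻¹)) ^ 2)⁻¹ • ∫ ω : EuclideanSpace ℝ ι, exp (-U (ω + ψ₀)) • U' (ω + ψ₀) ∂(multivariateGaussian 0 M⁻¹)).smulRight (∫ ω : EuclideanSpace ℝ ι, exp (-U (ω + ψ₀)) • U'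
        (ω + ψ₀) ∂(multivariateGaussian 0 M⁻¹)))).flip)).trans ?_
    rw [norm_inv, Real.norm_ofNat]
    have := norm_add_le ((∫ ω : EuclideanSpace ℝ ι, exp (-U (ω + ψ₀)) ∂(multivariateGaussian 0 M⁻¹))⁻¹ • (∫ ω : EuclideanSpace ℝ ι, exp (-U (ω + ψ₀)) • (U'' (ω + ψ₀) - (U'
        (ω + ψ₀)).smulRight (U' (ω + ψ₀))) ∂(multivariateGaussian 0 M⁻¹)) + (((∫ ω : EuclideanSpace ℝ ι, exp (-U (ω + ψ₀)) ∂(multivariateGaussian 0 M⁻¹)) ^ 2)⁻¹ • ∫ ω :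
        EuclideanSpace ℝ ι, exp (-U (ω + ψ₀)) • U' (ω + ψ₀) ∂(multivariateGaussian 0 M⁻¹)).smulRight (∫ ω : EuclideanSpace ℝ ι, exp (-U (ω + ψ₀)) • U' (ω + ψ₀)
        ∂(multivariateGaussian 0 M⁻¹))) (((∫ ω : EuclideanSpace ℝ ι, exp (-U (ω + ψ₀)) ∂(multivariateGaussian 0 M⁻¹))⁻¹ • (∫ ω : EuclideanSpace ℝ ι, exp (-U (ω + ψ₀)) •
        (U'' (ω + ψ₀) - (U' (ω + ψ₀)).smulRight (U' (ω + ψ₀))) ∂(multivariateGaussian 0 M⁻¹)) + (((∫ ω : EuclideanSpace ℝ ι, exp (-U (ω + ψ₀)) ∂(multivariateGaussian 0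
        M⁻¹)) ^ 2)⁻¹ • ∫ ω : EuclideanSpace ℝ ι, exp (-U (ω + ψ₀)) • U' (ω + ψ₀) ∂(multivariateGaussian 0 M⁻¹)).smulRight (∫ ω : EuclideanSpace ℝ ι, exp (-U (ω + ψ₀)) • U'
        (ω + ψ₀) ∂(multivariateGaussian 0 M⁻¹)))).flip
    nlinarith
  exact (norm_sub_le _ _).trans (by linarith)

/-- **THE OUTPUT'S GRADIENT LETTER**: `‖(w⁺)′(ζ)‖ ≤ 2(2λ+Λ)‖ζ‖ ≤ (2λ+Λ)(1 + Σ_iζ_i²)` at EVERY `ζ`. [folklore] -/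
theorem blockOutput_gradient_letter (hM : M.PosDef) (hfl : ∀ z : ι → ℝ, m * ∑ i, z i ^ 2 ≤ z ⬝ᵥ (M *ᵥ z)) (hΓop : (γop • (1 : Matrix ι ι ℝ) - M⁻¹).PosSemidef) (Y : Finset
    ι)
    (hUd : ∀ φ : EuclideanSpace ℝ ι, HasFDerivAt U (U' φ) φ) (hU'd : ∀ φ : EuclideanSpace ℝ ι, HasFDerivAt U' (U'' φ) φ)
    (hU''c : Continuous U'') (hκ₀ : 0 ≤ κ₀) (hκ₁ : 0 ≤ κ₁) (ha : 0 ≤ a) (hκ₂ : 0 ≤ κ₂) (hτ : 0 < τ) (hδ : 0 < δ) (hθ0 : 0 < θ) (hθ1 : θ < 1)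
    (hκθ : (2 * κ₀ * (1 + τ) + 4 * δ) * γop ≤ θ) (hstab : ∀ φ : EuclideanSpace ℝ ι, -(κ₀ * ∑ x ∈ Y, φ x ^ 2) ≤ U φ)
    (hU'b : ∀ φ : EuclideanSpace ℝ ι, ‖U' φ‖ ≤ κ₁ * (a + ∑ x ∈ Y, φ x ^ 2)) (hU''b : ∀ φ : EuclideanSpace ℝ ι, ‖U'' φ‖ ≤ κ₂) {Λ : ℝ} (hΛ : 0 ≤ Λ)
    (hwup : ∀ φ φ' : EuclideanSpace ℝ ι, U φ' ≤ U φ + U' φ (φ' - φ) + Λ / 2 * ∑ x ∈ Y, (φ' x - φ x) ^ 2) (hlam : 0 ≤ lam)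
    (hUsec : ∀ s : ℝ, 0 ≤ s → s ≤ 1 → ∀ a b : EuclideanSpace ℝ ι,
      U ((1 - s) • a + s • b) - lam / 2 * (s * (1 - s)) * ∑ i, (a i - b i) ^ 2 ≤ (1 - s) * U a + s * U b)
    (hm : 2 * lam ≤ m) (ψ₀ ζ : EuclideanSpace ℝ ι) :
    ‖(((∫ ω : EuclideanSpace ℝ ι, exp (-U (ω + (ψ₀ + ζ))) ∂(multivariateGaussian 0 M⁻¹))⁻¹ • ∫ ω : EuclideanSpace ℝ ι, exp (-U (ω + (ψ₀ + ζ))) • U' (ω + (ψ₀ + ζ))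
        ∂(multivariateGaussian 0 M⁻¹)) - ((∫ ω : EuclideanSpace ℝ ι, exp (-U (ω + ψ₀)) ∂(multivariateGaussian 0 M⁻¹))⁻¹ • ∫ ω : EuclideanSpace ℝ ι, exp (-U (ω + ψ₀)) • U'
        (ω + ψ₀) ∂(multivariateGaussian 0 M⁻¹)) - ((2 : ℝ)⁻¹ • (((∫ ω : EuclideanSpace ℝ ι, exp (-U (ω + ψ₀)) ∂(multivariateGaussian 0 M⁻¹))⁻¹ • (∫ ω : EuclideanSpace ℝ ι,
        exp (-U (ω + ψ₀)) • (U'' (ω + ψ₀) - (U' (ω + ψ₀)).smulRight (U' (ω + ψ₀))) ∂(multivariateGaussian 0 M⁻¹)) + (((∫ ω : EuclideanSpace ℝ ι, exp (-U (ω + ψ₀))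
        ∂(multivariateGaussian 0 M⁻¹)) ^ 2)⁻¹ • ∫ ω : EuclideanSpace ℝ ι, exp (-U (ω + ψ₀)) • U' (ω + ψ₀) ∂(multivariateGaussian 0 M⁻¹)).smulRight (∫ ω : EuclideanSpace ℝ
        ι, exp (-U (ω + ψ₀)) • U' (ω + ψ₀) ∂(multivariateGaussian 0 M⁻¹))) ζ + (((∫ ω : EuclideanSpace ℝ ι, exp (-U (ω + ψ₀)) ∂(multivariateGaussian 0 M⁻¹))⁻¹ • (∫ ω :
        EuclideanSpace ℝ ι, exp (-U (ω + ψ₀)) • (U'' (ω + ψ₀) - (U' (ω + ψ₀)).smulRight (U' (ω + ψ₀))) ∂(multivariateGaussian 0 M⁻¹)) + (((∫ ω : EuclideanSpace ℝ ι, exp (-U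
        (ω + ψ₀)) ∂(multivariateGaussian 0 M⁻¹)) ^ 2)⁻¹ • ∫ ω : EuclideanSpace ℝ ι, exp (-U (ω + ψ₀)) • U' (ω + ψ₀) ∂(multivariateGaussian 0 M⁻¹)).smulRight (∫ ω :
        EuclideanSpace ℝ ι, exp (-U (ω + ψ₀)) • U' (ω + ψ₀) ∂(multivariateGaussian 0 M⁻¹)))).flip ζ)))‖ ≤ 2 * (2 * lam + Λ) * ‖ζ‖ ∧
      ‖(((∫ ω : EuclideanSpace ℝ ι, exp (-U (ω + (ψ₀ + ζ))) ∂(multivariateGaussian 0 M⁻¹))⁻¹ • ∫ ω : EuclideanSpace ℝ ι, exp (-U (ω + (ψ₀ + ζ))) • U' (ω + (ψ₀ + ζ))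
          ∂(multivariateGaussian 0 M⁻¹)) - ((∫ ω : EuclideanSpace ℝ ι, exp (-U (ω + ψ₀)) ∂(multivariateGaussian 0 M⁻¹))⁻¹ • ∫ ω : EuclideanSpace ℝ ι, exp (-U (ω + ψ₀)) • U'
          (ω + ψ₀) ∂(multivariateGaussian 0 M⁻¹)) - ((2 : ℝ)⁻¹ • (((∫ ω : EuclideanSpace ℝ ι, exp (-U (ω + ψ₀)) ∂(multivariateGaussian 0 M⁻¹))⁻¹ • (∫ ω : EuclideanSpace ℝ
          ι, exp (-U (ω + ψ₀)) • (U'' (ω + ψ₀) - (U' (ω + ψ₀)).smulRight (U' (ω + ψ₀))) ∂(multivariateGaussian 0 M⁻¹)) + (((∫ ω : EuclideanSpace ℝ ι, exp (-U (ω + ψ₀))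
          ∂(multivariateGaussian 0 M⁻¹)) ^ 2)⁻¹ • ∫ ω : EuclideanSpace ℝ ι, exp (-U (ω + ψ₀)) • U' (ω + ψ₀) ∂(multivariateGaussian 0 M⁻¹)).smulRight (∫ ω : EuclideanSpace ℝ
          ι, exp (-U (ω + ψ₀)) • U' (ω + ψ₀) ∂(multivariateGaussian 0 M⁻¹))) ζ + (((∫ ω : EuclideanSpace ℝ ι, exp (-U (ω + ψ₀)) ∂(multivariateGaussian 0 M⁻¹))⁻¹ • (∫ ω :
          EuclideanSpace ℝ ι, exp (-U (ω + ψ₀)) • (U'' (ω + ψ₀) - (U' (ω + ψ₀)).smulRight (U' (ω + ψ₀))) ∂(multivariateGaussian 0 M⁻¹)) + (((∫ ω : EuclideanSpace ℝ ι, exp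
          (-U (ω + ψ₀)) ∂(multivariateGaussian 0 M⁻¹)) ^ 2)⁻¹ • ∫ ω : EuclideanSpace ℝ ι, exp (-U (ω + ψ₀)) • U' (ω + ψ₀) ∂(multivariateGaussian 0 M⁻¹)).smulRight (∫ ω :
          EuclideanSpace ℝ ι, exp (-U (ω + ψ₀)) • U' (ω + ψ₀) ∂(multivariateGaussian 0 M⁻¹)))).flip ζ)))‖ ≤ (2 * lam + Λ) * (1 + (∑ i, ζ i ^ 2)) := by
  have hmv := gradient_sub_le hM hfl hΓop Y hUd hU'd hU''c hκ₀ hκ₁ ha hκ₂ hτ hδ hθ0 hθ1 hκθ hstab hU'b hU''b hΛ hwup hlam hUsec hm ψ₀ (ψ₀ + ζ)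
  rw [add_sub_cancel_left] at hmv
  have h0 := hessW_opNorm_le hM hfl hΓop Y hUd hU'd hU''c hκ₀ hκ₁ ha hκ₂ hτ hδ hθ0 hθ1 hκθ hstab hU'b hU''b hΛ hwup hlam hUsec hm ψ₀
  have hK : ‖((2 : ℝ)⁻¹ • (((∫ ω : EuclideanSpace ℝ ι, exp (-U (ω + ψ₀)) ∂(multivariateGaussian 0 M⁻¹))⁻¹ • (∫ ω : EuclideanSpace ℝ ι, exp (-U (ω + ψ₀)) • (U'' (ω + ψ₀) -
      (U' (ω + ψ₀)).smulRight (U' (ω + ψ₀))) ∂(multivariateGaussian 0 M⁻¹)) + (((∫ ω : EuclideanSpace ℝ ι, exp (-U (ω + ψ₀)) ∂(multivariateGaussian 0 M⁻¹)) ^ 2)⁻¹ • ∫ ω :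
      EuclideanSpace ℝ ι, exp (-U (ω + ψ₀)) • U' (ω + ψ₀) ∂(multivariateGaussian 0 M⁻¹)).smulRight (∫ ω : EuclideanSpace ℝ ι, exp (-U (ω + ψ₀)) • U' (ω + ψ₀)
      ∂(multivariateGaussian 0 M⁻¹))) ζ + (((∫ ω : EuclideanSpace ℝ ι, exp (-U (ω + ψ₀)) ∂(multivariateGaussian 0 M⁻¹))⁻¹ • (∫ ω : EuclideanSpace ℝ ι, exp (-U (ω + ψ₀)) •
      (U'' (ω + ψ₀) - (U' (ω + ψ₀)).smulRight (U' (ω + ψ₀))) ∂(multivariateGaussian 0 M⁻¹)) + (((∫ ω : EuclideanSpace ℝ ι, exp (-U (ω + ψ₀)) ∂(multivariateGaussian 0 M⁻¹))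
      ^ 2)⁻¹ • ∫ ω : EuclideanSpace ℝ ι, exp (-U (ω + ψ₀)) • U' (ω + ψ₀) ∂(multivariateGaussian 0 M⁻¹)).smulRight (∫ ω : EuclideanSpace ℝ ι, exp (-U (ω + ψ₀)) • U' (ω + ψ₀)
      ∂(multivariateGaussian 0 M⁻¹)))).flip ζ))‖ ≤ (2 * lam + Λ) * ‖ζ‖ := by
    refine (norm_smul_le ((2 : ℝ)⁻¹) (((∫ ω : EuclideanSpace ℝ ι, exp (-U (ω + ψ₀)) ∂(multivariateGaussian 0 M⁻¹))⁻¹ • (∫ ω : EuclideanSpace ℝ ι, exp (-U (ω + ψ₀)) • (U''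
        (ω + ψ₀) - (U' (ω + ψ₀)).smulRight (U' (ω + ψ₀))) ∂(multivariateGaussian 0 M⁻¹)) + (((∫ ω : EuclideanSpace ℝ ι, exp (-U (ω + ψ₀)) ∂(multivariateGaussian 0 M⁻¹)) ^
        2)⁻¹ • ∫ ω : EuclideanSpace ℝ ι, exp (-U (ω + ψ₀)) • U' (ω + ψ₀) ∂(multivariateGaussian 0 M⁻¹)).smulRight (∫ ω : EuclideanSpace ℝ ι, exp (-U (ω + ψ₀)) • U' (ω + ψ₀)
        ∂(multivariateGaussian 0 M⁻¹))) ζ + (((∫ ω : EuclideanSpace ℝ ι, exp (-U (ω + ψ₀)) ∂(multivariateGaussian 0 M⁻¹))⁻¹ • (∫ ω : EuclideanSpace ℝ ι, exp (-U (ω + ψ₀)) •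
        (U'' (ω + ψ₀) - (U' (ω + ψ₀)).smulRight (U' (ω + ψ₀))) ∂(multivariateGaussian 0 M⁻¹)) + (((∫ ω : EuclideanSpace ℝ ι, exp (-U (ω + ψ₀)) ∂(multivariateGaussian 0
        M⁻¹)) ^ 2)⁻¹ • ∫ ω : EuclideanSpace ℝ ι, exp (-U (ω + ψ₀)) • U' (ω + ψ₀) ∂(multivariateGaussian 0 M⁻¹)).smulRight (∫ ω : EuclideanSpace ℝ ι, exp (-U (ω + ψ₀)) • U'
        (ω + ψ₀) ∂(multivariateGaussian 0 M⁻¹)))).flip ζ)).trans ?_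
    rw [norm_inv, Real.norm_ofNat]
    have h1 := ContinuousLinearMap.le_opNorm ((∫ ω : EuclideanSpace ℝ ι, exp (-U (ω + ψ₀)) ∂(multivariateGaussian 0 M⁻¹))⁻¹ • (∫ ω : EuclideanSpace ℝ ι, exp (-U (ω + ψ₀)) •
        (U'' (ω + ψ₀) - (U' (ω + ψ₀)).smulRight (U' (ω + ψ₀))) ∂(multivariateGaussian 0 M⁻¹)) + (((∫ ω : EuclideanSpace ℝ ι, exp (-U (ω + ψ₀)) ∂(multivariateGaussian 0
        M⁻¹)) ^ 2)⁻¹ • ∫ ω : EuclideanSpace ℝ ι, exp (-U (ω + ψ₀)) • U' (ω + ψ₀) ∂(multivariateGaussian 0 M⁻¹)).smulRight (∫ ω : EuclideanSpace ℝ ι, exp (-U (ω + ψ₀)) • U'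
        (ω + ψ₀) ∂(multivariateGaussian 0 M⁻¹))) ζ
    have h2 := ContinuousLinearMap.le_opNorm (((∫ ω : EuclideanSpace ℝ ι, exp (-U (ω + ψ₀)) ∂(multivariateGaussian 0 M⁻¹))⁻¹ • (∫ ω : EuclideanSpace ℝ ι, exp (-U (ω + ψ₀))
        • (U'' (ω + ψ₀) - (U' (ω + ψ₀)).smulRight (U' (ω + ψ₀))) ∂(multivariateGaussian 0 M⁻¹)) + (((∫ ω : EuclideanSpace ℝ ι, exp (-U (ω + ψ₀)) ∂(multivariateGaussian 0
        M⁻¹)) ^ 2)⁻¹ • ∫ ω : EuclideanSpace ℝ ι, exp (-U (ω + ψ₀)) • U' (ω + ψ₀) ∂(multivariateGaussian 0 M⁻¹)).smulRight (∫ ω : EuclideanSpace ℝ ι, exp (-U (ω + ψ₀)) • U'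
        (ω + ψ₀) ∂(multivariateGaussian 0 M⁻¹)))).flip ζ
    rw [ContinuousLinearMap.opNorm_flip] at h2
    have h3 := norm_add_le (((∫ ω : EuclideanSpace ℝ ι, exp (-U (ω + ψ₀)) ∂(multivariateGaussian 0 M⁻¹))⁻¹ • (∫ ω : EuclideanSpace ℝ ι, exp (-U (ω + ψ₀)) • (U'' (ω + ψ₀) -
        (U' (ω + ψ₀)).smulRight (U' (ω + ψ₀))) ∂(multivariateGaussian 0 M⁻¹)) + (((∫ ω : EuclideanSpace ℝ ι, exp (-U (ω + ψ₀)) ∂(multivariateGaussian 0 M⁻¹)) ^ 2)⁻¹ • ∫ ω :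
        EuclideanSpace ℝ ι, exp (-U (ω + ψ₀)) • U' (ω + ψ₀) ∂(multivariateGaussian 0 M⁻¹)).smulRight (∫ ω : EuclideanSpace ℝ ι, exp (-U (ω + ψ₀)) • U' (ω + ψ₀)
        ∂(multivariateGaussian 0 M⁻¹))) ζ) ((((∫ ω : EuclideanSpace ℝ ι, exp (-U (ω + ψ₀)) ∂(multivariateGaussian 0 M⁻¹))⁻¹ • (∫ ω : EuclideanSpace ℝ ι, exp (-U (ω + ψ₀)) •
        (U'' (ω + ψ₀) - (U' (ω + ψ₀)).smulRight (U' (ω + ψ₀))) ∂(multivariateGaussian 0 M⁻¹)) + (((∫ ω : EuclideanSpace ℝ ι, exp (-U (ω + ψ₀)) ∂(multivariateGaussian 0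
        M⁻¹)) ^ 2)⁻¹ • ∫ ω : EuclideanSpace ℝ ι, exp (-U (ω + ψ₀)) • U' (ω + ψ₀) ∂(multivariateGaussian 0 M⁻¹)).smulRight (∫ ω : EuclideanSpace ℝ ι, exp (-U (ω + ψ₀)) • U'
        (ω + ψ₀) ∂(multivariateGaussian 0 M⁻¹)))).flip ζ)
    nlinarith [norm_nonneg ζ]
  have hfirst : ‖(((∫ ω : EuclideanSpace ℝ ι, exp (-U (ω + (ψ₀ + ζ))) ∂(multivariateGaussian 0 M⁻¹))⁻¹ • ∫ ω : EuclideanSpace ℝ ι, exp (-U (ω + (ψ₀ + ζ))) • U' (ω + (ψ₀ +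
      ζ)) ∂(multivariateGaussian 0 M⁻¹)) - ((∫ ω : EuclideanSpace ℝ ι, exp (-U (ω + ψ₀)) ∂(multivariateGaussian 0 M⁻¹))⁻¹ • ∫ ω : EuclideanSpace ℝ ι, exp (-U (ω + ψ₀)) • U'
      (ω + ψ₀) ∂(multivariateGaussian 0 M⁻¹)) - ((2 : ℝ)⁻¹ • (((∫ ω : EuclideanSpace ℝ ι, exp (-U (ω + ψ₀)) ∂(multivariateGaussian 0 M⁻¹))⁻¹ • (∫ ω : EuclideanSpace ℝ ι,
      exp (-U (ω + ψ₀)) • (U'' (ω + ψ₀) - (U' (ω + ψ₀)).smulRight (U' (ω + ψ₀))) ∂(multivariateGaussian 0 M⁻¹)) + (((∫ ω : EuclideanSpace ℝ ι, exp (-U (ω + ψ₀))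
      ∂(multivariateGaussian 0 M⁻¹)) ^ 2)⁻¹ • ∫ ω : EuclideanSpace ℝ ι, exp (-U (ω + ψ₀)) • U' (ω + ψ₀) ∂(multivariateGaussian 0 M⁻¹)).smulRight (∫ ω : EuclideanSpace ℝ ι,
      exp (-U (ω + ψ₀)) • U' (ω + ψ₀) ∂(multivariateGaussian 0 M⁻¹))) ζ + (((∫ ω : EuclideanSpace ℝ ι, exp (-U (ω + ψ₀)) ∂(multivariateGaussian 0 M⁻¹))⁻¹ • (∫ ω :
      EuclideanSpace ℝ ι, exp (-U (ω + ψ₀)) • (U'' (ω + ψ₀) - (U' (ω + ψ₀)).smulRight (U' (ω + ψ₀))) ∂(multivariateGaussian 0 M⁻¹)) + (((∫ ω : EuclideanSpace ℝ ι, exp (-U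
      (ω + ψ₀)) ∂(multivariateGaussian 0 M⁻¹)) ^ 2)⁻¹ • ∫ ω : EuclideanSpace ℝ ι, exp (-U (ω + ψ₀)) • U' (ω + ψ₀) ∂(multivariateGaussian 0 M⁻¹)).smulRight (∫ ω :
      EuclideanSpace ℝ ι, exp (-U (ω + ψ₀)) • U' (ω + ψ₀) ∂(multivariateGaussian 0 M⁻¹)))).flip ζ)))‖ ≤ 2 * (2 * lam + Λ) * ‖ζ‖ := by
    refine (norm_sub_le _ _).trans ?_
    linarith
  refine ⟨hfirst, hfirst.trans ?_⟩
  rw [← EuclideanSpace.real_norm_sq_eq]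
  nlinarith [sq_nonneg (‖ζ‖ - 1), norm_nonneg ζ, show 0 ≤ 2 * lam + Λ by positivity]

end Second

/-! ## §3. Toy -/

/-- Toy (§1): the zero form has operator norm `≤ 0`. -/
example : ‖(0 : EuclideanSpace ℝ ι →L[ℝ] EuclideanSpace ℝ ι →L[ℝ] ℝ)‖ ≤ 0 :=
  opNorm_le_of_symm_form_bound 0 (fun _ _ => rfl) le_rfl (fun v => by simp)

end Summit.QuantumFields.BalabanUV.T4Continuum.NE7b.SupBlockHessianBound
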